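import Mathlib
import Summits.ValiantsHypothesis.ValiantsHypothesis.Theorems.FreeSubtorusConfusionCoveringGenericElement

/-!
# `OrbitDimensionBound` (stmt-ValiantsHypothesis-16133), rung line `no_minor_covering` — stub `stub_genericElementNoMinor`

The line `Cruxes/OrbitDimensionBound/Lines/no_minor_covering.lean` (route `FreeSubtorus`, forward rung `NoMinorCovering`:
the covering bound `C(n,⌊n/2⌋) ≤ m · 2^r` for lattice data `Λ` with NO INVARIANT PROPER MINOR instead of admissibility)
registers three stubs; this file proves the first,

  `stub_genericElementNoMinor` (statement = the line's, with the Cruxes-side `NoInvariantMinor` / `InSpan` / `minorVec`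
  of `Lines/NoMinorLadder.lean` UNFOLDED; no definitions here):

for ARBITRARY `Λ` (no row-sum hypothesis) there is `(d, e) ∈ (ℂˣ)ⁿ × (ℂˣ)ⁿ` with (i) the relations of `T_Λ`, (ii) EXACT
SEPARATION — a character trivial on `(d, e)` has a non-zero multiple in `ℤΛ` — and (iii) JUNK-FREENESS along
permutations: for every `σ ∈ 𝔖_n` and every proper non-empty row set `M`, `∏_{k ∈ M} d_k e_{σ k} ≠ 1`, PROVIDED no
indicator character `(1_M ; 1_{σ M})` of a proper sub-matching lies in `span_ℚ Λ` (`NoInvariantMinor`).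

**Proof.**  (i), (ii): the Liouville construction of the tree's `stub_genericElement`
(`Theorems/FreeSubtorusConfusionCoveringGenericElement.lean`): `d_k = exp(w_{inl k})`, `e_l = exp(w_{inr l})` for real
weights `w` with `Σ_x z_x w_x = 0 ⇔ z ∈ span_ℚ Λ` (`exists_generic_weights`); that file's row-sum hypothesis is used only
for its clause «no non-negative relation», which this stub does not state.  (iii): `∏_{k∈M} d_k e_{σk}` is the character
`minorVec σ M = (1_M ; 1_{σM})` evaluated at `(d, e)`; if it is `1`, exact separation puts `minorVec σ M` in `span_ℚ Λ`,
contradicting `NoInvariantMinor`.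

Helper mode (`--supports stmt-ValiantsHypothesis-16133 --as helper`): the item's registered skeleton is `affine_multiple`;
no stub credit moves.  Honest framing: bookkeeping stub of a rung line whose core `stub_kernelCycle` (and the normal-form
stub `stub_gradedNormalForm`) remain OPEN; the crux `OrbitDimensionBound`, the route `FreeSubtorus` and VP ≠ VNP are OPEN
and NOT moved by this file.

## References
* [LandsbergRessayre2017] J. M. Landsberg, N. Ressayre, *Permanent v. determinant: an exponential lower bound assuming
  symmetry and a potential path towards Valiant's conjecture*, Differential Geom. Appl. 55 (2017), §6.
-/

open Finset
open Summit.ValiantsHypothesis.ValiantsHypothesis.Theorems.FreeSubtorusConfusionCovering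

-- the mandated summit-side namespace repeats a component by design (single-problem summit)
set_option linter.dupNamespace false

namespace Summit.ValiantsHypothesis.ValiantsHypothesis.Theorems.FreeSubtorusOrbitDimensionBound.NoMinorCovering

noncomputable section

/-- The character of a sub-matching evaluated at `(d, e)`: `∏_k d_k^{[k ∈ M]} · ∏_l e_l^{[σ⁻¹ l ∈ M]} = ∏_{k∈M} d_k e_{σ k}`.
[folklore] -/
theorem minor_character_eq_prod {n : ℕ} (d e : Fin n → ℂˣ) (σ : Equiv.Perm (Fin n)) (M : Finset (Fin n)) :
    (((∏ k, (d k) ^ ((Sum.elim (fun k => if k ∈ M then 1 else 0) (fun l => if σ.symm l ∈ M then 1 else 0) :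
          (Fin n ⊕ Fin n) → ℤ) (Sum.inl k))) *
      (∏ l, (e l) ^ ((Sum.elim (fun k => if k ∈ M then 1 else 0) (fun l => if σ.symm l ∈ M then 1 else 0) :
          (Fin n ⊕ Fin n) → ℤ) (Sum.inr l))) : ℂˣ) : ℂ) =
      ∏ k ∈ M, ((d k : ℂ) * (e (σ k) : ℂ)) := by
  classical
  simp only [Sum.elim_inl, Sum.elim_inr]
  have hd : (∏ k, d k ^ (if k ∈ M then (1 : ℤ) else 0)) = ∏ k ∈ M, d k := by
    calc (∏ k, d k ^ (if k ∈ M then (1 : ℤ) else 0)) = ∏ k, (if k ∈ M then d k else 1) :=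
          Finset.prod_congr rfl fun k _ => by split_ifs <;> simp
      _ = ∏ k ∈ M, d k := by rw [Finset.prod_ite_mem, Finset.univ_inter]
  have he : (∏ l, e l ^ (if σ.symm l ∈ M then (1 : ℤ) else 0)) = ∏ k ∈ M, e (σ k) := by
    calc (∏ l, e l ^ (if σ.symm l ∈ M then (1 : ℤ) else 0))
        = ∏ k, e (σ k) ^ (if σ.symm (σ k) ∈ M then (1 : ℤ) else 0) :=
          (Equiv.prod_comp σ (fun l => e l ^ (if σ.symm l ∈ M then (1 : ℤ) else 0))).symm
      _ = ∏ k, (if k ∈ M then e (σ k) else 1) :=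
          Finset.prod_congr rfl fun k _ => by rw [Equiv.symm_apply_apply]; split_ifs <;> simp
      _ = ∏ k ∈ M, e (σ k) := by rw [Finset.prod_ite_mem, Finset.univ_inter]
  rw [hd, he, Units.val_mul, Units.coe_prod, Units.coe_prod, ← Finset.prod_mul_distrib]

/-- **Stub `stub_genericElementNoMinor` of the line `no_minor_covering`** (statement = the line's, with `NoInvariantMinor`,
`InSpan`, `minorVec` unfolded): a generic element of `T_Λ` for ARBITRARY `Λ`, with the relations, exact separation, and —
when `Λ` has no invariant proper minor — no proper sub-matching of any permutation of weight `1`.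
[cite: LandsbergRessayre2017, §6] -/
theorem stub_genericElementNoMinor :
    ∀ (n r : ℕ) (Λ : Fin r → (Fin n ⊕ Fin n) → ℤ),
    (∀ (σ : Equiv.Perm (Fin n)) (A : Finset (Fin n)), A.Nonempty → A ≠ Finset.univ →
      ¬ ∃ c : Fin r → ℚ, ∀ x,
        ((Sum.elim (fun k => if k ∈ A then 1 else 0) (fun l => if σ.symm l ∈ A then 1 else 0) :
            (Fin n ⊕ Fin n) → ℤ) x : ℚ) = ∑ i, c i * (Λ i x : ℚ)) →
    ∃ d e : Fin n → ℂˣ,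
      (∀ i, (∏ k, (d k) ^ (Λ i (Sum.inl k))) * (∏ l, (e l) ^ (Λ i (Sum.inr l))) = 1) ∧
      (∀ χ : (Fin n ⊕ Fin n) → ℤ,
        (∏ k, (d k) ^ (χ (Sum.inl k))) * (∏ l, (e l) ^ (χ (Sum.inr l))) = 1 →
        ∃ (N : ℤ) (a : Fin r → ℤ), N ≠ 0 ∧ N • χ = ∑ i, a i • Λ i) ∧
      (∀ (σ : Equiv.Perm (Fin n)) (M : Finset (Fin n)), M.Nonempty → M ≠ Finset.univ →
        (∏ k ∈ M, ((d k : ℂ) * (e (σ k) : ℂ))) ≠ 1) := by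
  intro n r Λ hNoMinor
  classical
  obtain ⟨w, hw⟩ := exists_generic_weights Λ
  -- the element
  set d : Fin n → ℂˣ := fun k => Units.mk0 (Complex.exp (w (Sum.inl k) : ℂ)) (Complex.exp_ne_zero _) with hd
  set e : Fin n → ℂˣ := fun l => Units.mk0 (Complex.exp (w (Sum.inr l) : ℂ)) (Complex.exp_ne_zero _) with he
  have hdval : ∀ k, (d k : ℂ) = Complex.exp (w (Sum.inl k) : ℂ) := fun k => rfl
  have heval : ∀ l, (e l : ℂ) = Complex.exp (w (Sum.inr l) : ℂ) := fun l => rfl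
  -- characters evaluate to `exp (Σ_x χ_x w_x)`
  have hchar : ∀ χ : (Fin n ⊕ Fin n) → ℤ,
      (((∏ k, (d k) ^ (χ (Sum.inl k))) * (∏ l, (e l) ^ (χ (Sum.inr l))) : ℂˣ) : ℂ) =
        Complex.exp ((∑ x, (χ x : ℝ) * w x : ℝ) : ℂ) := by
    intro χ
    rw [Units.val_mul, units_prod_zpow_eq_exp d _ hdval, units_prod_zpow_eq_exp e _ heval, ← Complex.exp_add,
      ← Complex.ofReal_add, Fintype.sum_sum_type]
  have hchar1 : ∀ χ : (Fin n ⊕ Fin n) → ℤ,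
      (∏ k, (d k) ^ (χ (Sum.inl k))) * (∏ l, (e l) ^ (χ (Sum.inr l))) = 1 ↔
        ∃ c : Fin r → ℚ, ∀ x, (χ x : ℚ) = ∑ i, c i * (Λ i x : ℚ) := by
    intro χ
    rw [← hw χ, ← exp_ofReal_eq_one_iff, ← hchar χ, Units.val_eq_one]
  refine ⟨d, e, fun i => ?_, fun χ hχ => ?_, fun σ M hM hMu hprod => ?_⟩
  · -- (i) the relations: `Λ_i` is a rational combination of the `Λ`'s
    rw [hchar1]
    refine ⟨fun j => if j = i then 1 else 0, fun x => ?_⟩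
    simp only [ite_mul, one_mul, zero_mul, Finset.sum_ite_eq', mem_univ, if_true]
  · -- (ii) exact separation
    rw [hchar1] at hχ
    obtain ⟨c, hc⟩ := hχ
    exact exists_int_combination Λ χ c hc
  · -- (iii) junk-freeness along permutations
    set χ : (Fin n ⊕ Fin n) → ℤ :=
      Sum.elim (fun k => if k ∈ M then 1 else 0) (fun l => if σ.symm l ∈ M then 1 else 0) with hχdef
    have hval : (((∏ k, (d k) ^ (χ (Sum.inl k))) * (∏ l, (e l) ^ (χ (Sum.inr l))) : ℂˣ) : ℂ) = 1 := by
      rw [hχdef, minor_character_eq_prod d e σ M, hprod]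
    have h1 : (∏ k, (d k) ^ (χ (Sum.inl k))) * (∏ l, (e l) ^ (χ (Sum.inr l))) = 1 :=
      Units.val_eq_one.mp hval
    rw [hchar1] at h1
    exact hNoMinor σ M hM hMu h1

end

end Summit.ValiantsHypothesis.ValiantsHypothesis.Theorems.FreeSubtorusOrbitDimensionBound.NoMinorCovering
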